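import Summits.HodgeConjecture.CorCM.DihedralSexticPairFrameTransfer
import Summits.HodgeConjecture.CorCM.DihedralSexticPairWeights
import Summits.HodgeConjecture.CorCM.Model.CMSliceOfWeilFaces
import HarnessLib

/-!
# COR-CM — the Hodge conjecture for the product `B₀ × B₁` of two Galois-conjugate, non-isogenous simple CM threefolds
# of a NON-Galois sextic CM field `K = k·F₀`, modulo Markman's fourfold theorem

Cell `pub-hodgecm2` (COR-CM = stage 2 of the Hodge ladder), seat b30 gen 14 (2026-08-21); COUNT-NEUTRAL (no row of
`HOME/BINDER-OWNERS.md`); theorems only, no definition, no named fact, no `sorry`.  Third file of the seat's Markman road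
beyond Galois sextics (`CorCM/CMThreefoldPairWeilClassesOfMarkman.lean` p249751/p250027: the `k`-Weil `(3,3)`-classes
of a product of two CM threefolds over one imaginary quadratic field are algebraic modulo Markman;
`Census/DihedralSexticPair.lean`: the finite model).

SETTING.  `k` an imaginary quadratic field (`[k:ℚ] = 2`, CM), `K` a sextic CM field, `i : k → K`, `δ ∈ 𝓞_k` with
`δ² = -d`, `d ≥ 1`, `τ : k → ℂ` with `τ(δ) = i√d`; two realisations `A₀ ⊨ (K; Φ₀)`, `A₁ ⊨ (K; Φ₁)` (the tree's
`IsCMTypeRealisation`).  A FRAME of `K` over `(k, i, τ)` is a bijection `e : Hom(K, ℂ) ≃ ℤ/3 × Bool` ("real place",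
"sign") such that: complex conjugation keeps the place and flips the sign (`he_conj`); the sign of `s` is `true` iff
`s ∘ i = τ` (`he_sign`); and the six sign-preserving permutations `(p, b) ↦ (±p + j, b)` are realised by automorphisms of
`ℂ` (`he_gal`) — this is the statement «`Gal(K^{gal}/ℚ) = S₃ × C₂` acts on `Hom(K, ℚ̄) = Hom(F₀, ℝ) × Hom(k, ℂ)`
factorwise», i.e. `K = k·F₀` with `F₀` a NON-cyclic totally real cubic; in the frame, `Φ_j` is the type with sign `true`
exactly over the place `j` (`hΦ`, `j = 0, 1`): `A₀`, `A₁` are two of the three Galois-conjugate, pairwise non-isogenous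
simple CM threefolds of `K` with primitive types (`Census/DihedralSexticFace.lean`, docstring MODEL).

MAIN THEOREM `hodgeConjectureFor_biproduct_of_frame_of_markman`: under a frame, **`HodgeConjectureFor (A₀ ⊕ A₁)`** —
every rational `(p,p)`-class on the abelian sixfold `⨁_{j<2} A_j` is algebraic, for every `p` — GIVEN ONLY
`Markman2025_weilClasses_algebraic_abelianFourfold`; `hodgeConjectureFor_prod_of_frame_of_markman` (the tree's
`A₀.prod A₁`) and `hodgeConjectureFor_of_avDominatedBy_of_frame_of_markman` (every abelian variety dominated by,
i.e. an isogeny factor of, `A₀ ⊕ A₁`) follow.  NOT covered: powers `A₀^a × A₁^b` with `a ≥ 2` or `b ≥ 2` — their Hodge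
rings contain further balanced weights (e.g. on `A₀² × A₁` the `6`-set taking the three `τ`-places of `A₀` from two
different copies), which are not weights of `A₀ × A₁` pulled back along a projection (seat note, v2).

PROOF.  Pohlmann's theorem for the CM algebra `K × K` (tree theorem `Pohlmann1968_thm1_cmAlgebra`): `Bᵖ ⊗ ℂ` is the
sum of the weight lines `H_S` over the `Aut(ℂ)`-balanced `2p`-subsets `S ⊆ Hom(K,ℂ) ⊔ Hom(K,ℂ)`
(`IsGaloisBalancedAlg`).  FRAME TRANSFER (`CorCM/DihedralSexticPairFrameTransfer.lean`): through `(j, s) ↦ (j, e s)`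
a balanced `S` becomes a balanced weight of the 12-point model (`Census.DihedralSexticPair.balanced`), because the
twelve elements of `S₃ × C₂` are realised by automorphisms of `ℂ` and membership in `Φ_j` is read in the frame; by the
kernel census
`Census.DihedralSexticPair.balanced_classification` the model weight is conjugation-stable or one of the two `k`-Weil
weights `W_±`.  Conjugation-stable `S` index divisor monomials, algebraic (`PairWeights.weightClassesAlg_le_
algebraicClasses_of_conj_smul_mem`: Lefschetz `(1,1)` + cup products).  `W₊ = {(0,s) : s∘i = τ} ⊔ {(1,s) : s∘i = τ̄}`
has the constant eigenvalue `+i√d` for the `k`-structure `φ = ι₀(iδ) ⊕ ι₁(īδ)` (`ī = i ∘ c_k`), so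
`H_{W₊} ⊆ E₊(⨁ A, φ)` (`PairWeights.weightClassesAlg_le_weilClassesPlus`), and `W₋ ⊆ E₋`; the fibre counts of `Φ₀`
over `τ` via `i` and of `Φ₁` over `τ` via `ī` are `1` and `2`, so the whole Weil plane `E₊ ⊔ E₋` of
`(A₀ × A₁, ι₀(iδ) × ι₁(īδ))` is algebraic modulo Markman by the seat's
`CMThreefoldPair.weilClassesOf_prod_le_algebraicClasses_of_markman_curveFree`, transported to `⨁_{j<2} A_j`
(`PairWeights.weilClassesOf_biproduct_le_algebraicClasses_of_prod`).

HONEST FRAMING.  Conditional on Markman's theorem only; the frame hypotheses are explicit data about `K ⊇ i(k)` (they hold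
iff `K⁺` is a non-Galois cubic, i.e. iff the sextic CM field `K ⊇ k` is not Galois over `ℚ` — not derived in this file).
`HC_CM` is not asserted; wording of record untouched.

## References
* [Markman2025SurveySecant] E. Markman, arXiv:2509.23403, Thm. 1.2 and §11.5 Step 2 (the displayed hypothesis).
* [Pohlmann1968] H. Pohlmann, Ann. of Math. 88 (1968), Thm 1.  [GaoUllmo2025] Z. Gao, E. Ullmo, J. Inst. Math. Jussieu
  25 (2025), Thm 3.1.  [Gordon1999HodgeAVSurvey] B. B. Gordon, CRM Monogr. 10 (1999), §9.2, 9.2.2.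
* [vanGeemen1994HodgeAV] B. van Geemen, LNM 1594 (1994), §2.4, 3.7, 4.9, Thm. 6.12.
* [Deligne1982HodgeCycles] P. Deligne (notes by J. S. Milne), LNM 900 (1982), §5 (c).
* [MoonenZarhin1999LowDim] B. Moonen, Yu. Zarhin, Duke Math. J. 98 (1999), Thm. 0.1 (the shape `B• = D• + W_k`).
-/

noncomputable section

open CategoryTheory CategoryTheory.Limits NumberField

namespace Summit.HodgeConjecture.CorCM.DihedralSexticPair

open Literature.AlgebraicGeometry Literature.AlgebraicGeometry.Motives Literature.AlgebraicGeometry.HodgeTheory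
open Literature.AlgebraicGeometry.ComplexMultiplication (IsCMTypeRealisation)
open Literature.AlgebraicGeometry.Pohlmann1968
open Literature.AlgebraicTopology.SingularHomology
open Literature.NumberTheory.ComplexMultiplication
open Summit.HodgeConjecture.CorCM.Census.DihedralSexticPair (balanced_classification)
open Summit.HodgeConjecture.CorCM.PairWeights

open scoped Classical

/-! ## The Hodge conjecture for `A₀ ⊕ A₁` modulo Markman -/

section Main

variable {K : Type} [Field K] [NumberField K] [IsCMField K] {k : Type} [Field k] [NumberField k] [IsCMField k]
  {A : Fin 2 → AbelianVariety ℂ} {Φ : Fin 2 → CMType K} {ι : ∀ j, 𝓞 K →+* End (A j)}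
  {θ : ∀ j, K →+* Module.End ℂ (complexBetti (A j).X 1)}

omit [IsCMField K] in
/-- **The Weil plane of `(⨁_{j<2} A_j, ι₀(iδ) ⊕ ι₁(īδ))` is algebraic modulo Markman** in a frame (fibre counts `1`,
`2`; the seat's `CMThreefoldPair.weilClassesOf_prod_le_algebraicClasses_of_markman_curveFree` transported from
`A₀ × A₁`). [cite: Markman2025SurveySecant, Thm. 1.2 and §11.5 Step 2] [cite: Deligne1982HodgeCycles, §5 (c)] -/
theorem weilClassesOf_biproduct_le_algebraicClasses_of_frame_of_markman
    (hW4 : Markman2025_weilClasses_algebraic_abelianFourfold)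
    (h6 : Module.finrank ℚ K = 6) (h2 : Module.finrank ℚ k = 2) (i : k →+* K)
    {δ : 𝓞 k} {d : ℕ} (hd : 0 < d) (hδ : ((δ : k)) ^ 2 = -(d : k))
    {τ : k →+* ℂ} (hτ : τ (δ : k) = Complex.I * (Real.sqrt d : ℂ))
    (hA : ∀ j, IsCMTypeRealisation (Φ j) (A j) (ι j) (θ j))
    {e : (K →+* ℂ) ≃ ZMod 3 × Bool} (he_sign : ∀ s : K →+* ℂ, s.comp i = τ ↔ (e s).2 = true)
    (hΦ : ∀ (j : Fin 2) (s : K →+* ℂ), s ∈ (Φ j).1 ↔ (e s).2 = decide ((e s).1.val = j.val)) :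
    weilClassesOf (⨁ A) (biproduct.map fun j => ι j (![RingOfIntegers.mapRingHom i δ,
        RingOfIntegers.mapRingHom (i.comp (IsCMField.complexConj k).toRingEquiv.toRingHom) δ] j)) 3 d ≤
      algebraicClasses (⨁ A).X 3 :=
  weilClassesOf_biproduct_le_algebraicClasses_of_prod (fun j => ι j (![RingOfIntegers.mapRingHom i δ,
      RingOfIntegers.mapRingHom (i.comp (IsCMField.complexConj k).toRingEquiv.toRingHom) δ] j))
    (CMThreefoldPair.weilClassesOf_prod_le_algebraicClasses_of_markman_curveFree hW4 h6 h6 h2 i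
      (i.comp (IsCMField.complexConj k).toRingEquiv.toRingHom) (hA 0) (hA 1) hd hδ hτ
      (card_fibre_zero he_sign hΦ) (card_fibre_one he_sign hΦ h2 hd hτ))

/-- **MAIN THEOREM.  The Hodge conjecture for `A₀ ⊕ A₁` — two Galois-conjugate, non-isogenous simple CM threefolds of
a non-Galois sextic CM field `K = k·F₀`, given by a frame — modulo Markman's fourfold theorem only.**  Every rational
`(p,p)`-class on `⨁_{j<2} A_j` is algebraic, for every `p`: `Bᵖ ⊗ ℂ = Σ_S H_S` over balanced weights (Pohlmann, CM
algebra `K × K`); a balanced weight is conjugation-stable (divisor monomial, algebraic) or a `k`-Weil weight (a line of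
the Weil plane of `ι₀(iδ) ⊕ ι₁(īδ)`, algebraic modulo Markman). [cite: Pohlmann1968, Thm 1] [cite: GaoUllmo2025, Thm 3.1]
[cite: Gordon1999HodgeAVSurvey, 9.2.2] [cite: Markman2025SurveySecant, Thm. 1.2] [cite: MoonenZarhin1999LowDim, Thm. 0.1] -/
theorem hodgeConjectureFor_biproduct_of_frame_of_markman
    (hW4 : Markman2025_weilClasses_algebraic_abelianFourfold)
    (h6 : Module.finrank ℚ K = 6) (h2 : Module.finrank ℚ k = 2) (i : k →+* K)
    {δ : 𝓞 k} {d : ℕ} (hd : 0 < d) (hδ : ((δ : k)) ^ 2 = -(d : k))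
    {τ : k →+* ℂ} (hτ : τ (δ : k) = Complex.I * (Real.sqrt d : ℂ))
    (hA : ∀ j, IsCMTypeRealisation (Φ j) (A j) (ι j) (θ j))
    (e : (K →+* ℂ) ≃ ZMod 3 × Bool)
    (he_conj : ∀ s : K →+* ℂ, e (ComplexEmbedding.conjugate s) = ((e s).1, !(e s).2))
    (he_sign : ∀ s : K →+* ℂ, s.comp i = τ ↔ (e s).2 = true)
    (he_gal : ∀ (j : ZMod 3) (f : Bool), ∃ σ : ℂ ≃+* ℂ, ∀ s : K →+* ℂ,
      e ((σ : ℂ →+* ℂ).comp s) = ((if f then -(e s).1 else (e s).1) + j, (e s).2))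
    (hΦ : ∀ (j : Fin 2) (s : K →+* ℂ), s ∈ (Φ j).1 ↔ (e s).2 = decide ((e s).1.val = j.val)) :
    HodgeConjectureFor (⨁ A).dim (⨁ A).X := by
  refine ⟨nonempty_hodgeModel_holds (Motives.AbelianVariety.isSmoothProjective_holds (A := ⨁ A)),
    fun p c hc hH => ?_⟩
  have hmem : c ∈ ⨆ S ∈ pohlmannSetsAlg Φ p, weightClassesAlg A ι (2 * p) S := by
    rw [← (Pohlmann1968_thm1_cmAlgebra (fun _ => K) A Φ ι θ hA p).1]
    exact Submodule.subset_span ⟨hc, hH⟩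
  set a : Fin 2 → 𝓞 K := ![RingOfIntegers.mapRingHom i δ,
    RingOfIntegers.mapRingHom (i.comp (IsCMField.complexConj k).toRingEquiv.toRingHom) δ] with ha_def
  have hWeil : weilClassesOf (⨁ A) (biproduct.map fun j => ι j (a j)) 3 d ≤ algebraicClasses (⨁ A).X 3 :=
    weilClassesOf_biproduct_le_algebraicClasses_of_frame_of_markman hW4 h6 h2 i hd hδ hτ hA he_sign hΦ
  have hle : (⨆ S ∈ pohlmannSetsAlg Φ p, weightClassesAlg A ι (2 * p) S) ≤ algebraicClasses (⨁ A).X p := by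
    refine iSup₂_le fun S hS => ?_
    rcases balanced_classification _ (balanced_image_of_isGaloisBalancedAlg hΦ he_conj he_gal hS.2) with
      hcs | hplus | hminus
    · exact weightClassesAlg_le_algebraicClasses_of_conj_smul_mem hA hS.1
        (conj_smul_mem_of_conjStable_image he_conj hcs)
    · obtain ⟨hmemS, hcard⟩ := mem_iff_of_image_eq_weilPlus hplus
      obtain rfl : p = 3 := by have := hS.1; omega
      refine (weightClassesAlg_le_weilClassesPlus (K := fun _ => K) a hS.1 fun z hz => ?_).trans
        ((weilClassesPlus_le_weilClassesOf _ _ 3 d).trans hWeil)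
      exact (apply_weilFamily_eq he_sign h2 hd hτ z).1 ((hmemS z).1 hz)
    · obtain ⟨hmemS, hcard⟩ := mem_iff_of_image_eq_weilMinus hminus
      obtain rfl : p = 3 := by have := hS.1; omega
      refine (weightClassesAlg_le_weilClassesMinus (K := fun _ => K) a hS.1 fun z hz => ?_).trans
        ((weilClassesMinus_le_weilClassesOf _ _ 3 d).trans hWeil)
      exact (apply_weilFamily_eq he_sign h2 hd hτ z).2 ((hmemS z).1 hz)
  exact hle hmem

/-- **The Hodge conjecture for `A₀ × A₁`** (the tree's `AbelianVariety.prod`) in a frame, modulo Markman.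
[cite: Markman2025SurveySecant, Thm. 1.2] [cite: vanGeemen1994HodgeAV, Lemma 3.7] -/
theorem hodgeConjectureFor_prod_of_frame_of_markman
    (hW4 : Markman2025_weilClasses_algebraic_abelianFourfold)
    (h6 : Module.finrank ℚ K = 6) (h2 : Module.finrank ℚ k = 2) (i : k →+* K)
    {δ : 𝓞 k} {d : ℕ} (hd : 0 < d) (hδ : ((δ : k)) ^ 2 = -(d : k))
    {τ : k →+* ℂ} (hτ : τ (δ : k) = Complex.I * (Real.sqrt d : ℂ))
    (hA : ∀ j, IsCMTypeRealisation (Φ j) (A j) (ι j) (θ j))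
    (e : (K →+* ℂ) ≃ ZMod 3 × Bool)
    (he_conj : ∀ s : K →+* ℂ, e (ComplexEmbedding.conjugate s) = ((e s).1, !(e s).2))
    (he_sign : ∀ s : K →+* ℂ, s.comp i = τ ↔ (e s).2 = true)
    (he_gal : ∀ (j : ZMod 3) (f : Bool), ∃ σ : ℂ ≃+* ℂ, ∀ s : K →+* ℂ,
      e ((σ : ℂ →+* ℂ).comp s) = ((if f then -(e s).1 else (e s).1) + j, (e s).2))
    (hΦ : ∀ (j : Fin 2) (s : K →+* ℂ), s ∈ (Φ j).1 ↔ (e s).2 = decide ((e s).1.val = j.val)) :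
    HodgeConjectureFor ((A 0).prod (A 1)).dim ((A 0).prod (A 1)).X :=
  hodgeConjectureFor_prod_of_biproduct
    (hodgeConjectureFor_biproduct_of_frame_of_markman hW4 h6 h2 i hd hδ hτ hA e he_conj he_sign he_gal hΦ)

/-- **The Hodge conjecture for every abelian variety dominated by `A₀ ⊕ A₁`** (its isogeny factors: `AVDominatedBy`,
`Domination.hodgeConjectureFor_of_avDominatedBy`; powers `A₀^a × A₁^b`, `a` or `b ≥ 2`, are NOT dominated by
`A₀ ⊕ A₁` and not covered) in a frame, modulo Markman. [cite: Markman2025SurveySecant, Thm. 1.2]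
[cite: MumfordAV1970, §19 Thm. 1] -/
theorem hodgeConjectureFor_of_avDominatedBy_of_frame_of_markman
    (hW4 : Markman2025_weilClasses_algebraic_abelianFourfold)
    (h6 : Module.finrank ℚ K = 6) (h2 : Module.finrank ℚ k = 2) (i : k →+* K)
    {δ : 𝓞 k} {d : ℕ} (hd : 0 < d) (hδ : ((δ : k)) ^ 2 = -(d : k))
    {τ : k →+* ℂ} (hτ : τ (δ : k) = Complex.I * (Real.sqrt d : ℂ))
    (hA : ∀ j, IsCMTypeRealisation (Φ j) (A j) (ι j) (θ j))
    (e : (K →+* ℂ) ≃ ZMod 3 × Bool)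
    (he_conj : ∀ s : K →+* ℂ, e (ComplexEmbedding.conjugate s) = ((e s).1, !(e s).2))
    (he_sign : ∀ s : K →+* ℂ, s.comp i = τ ↔ (e s).2 = true)
    (he_gal : ∀ (j : ZMod 3) (f : Bool), ∃ σ : ℂ ≃+* ℂ, ∀ s : K →+* ℂ,
      e ((σ : ℂ →+* ℂ).comp s) = ((if f then -(e s).1 else (e s).1) + j, (e s).2))
    (hΦ : ∀ (j : Fin 2) (s : K →+* ℂ), s ∈ (Φ j).1 ↔ (e s).2 = decide ((e s).1.val = j.val))
    {B : AbelianVariety ℂ} (hB : Domination.AVDominatedBy B (⨁ A)) : HodgeConjectureFor B.dim B.X :=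
  Domination.hodgeConjectureFor_of_avDominatedBy
    (hodgeConjectureFor_biproduct_of_frame_of_markman hW4 h6 h2 i hd hδ hτ hA e he_conj he_sign he_gal hΦ) hB

end Main

end Summit.HodgeConjecture.CorCM.DihedralSexticPair

end
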